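import Summits.ValiantsHypothesis.ValiantsHypothesis.Theses.ValuativeGCT
import Summits.ValiantsHypothesis.ValiantsHypothesis.Theorems.ValuativeGCTValuativeBound
import Summits.ValiantsHypothesis.ValiantsHypothesis.Theorems.ValuativeGCTHeadFlipHolds
import Summits.ValiantsHypothesis.ValiantsHypothesis.Theorems.ValuativeGCTValuativeFlipTailSuffices
import Summits.ValiantsHypothesis.ValiantsHypothesis.Theorems.ValuativeGCTValuativeFlipInnerMonotone
import Summits.ValiantsHypothesis.ValiantsHypothesis.Theorems.ValuativeGCTValuativeFlipBottomWindow
import Summits.ValiantsHypothesis.ValiantsHypothesis.Theorems.ValuativeGCTValuativeFlipBorderPaddingMonotone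
import Summits.ValiantsHypothesis.ValiantsHypothesis.Theorems.ValuativeGCTValuativeFlipBorderComplexityWindow
import Summits.ValiantsHypothesis.ValiantsHypothesis.Theorems.TailFlip.Negative.TailFlipLoadBearing
import Summits.ValiantsHypothesis.ValiantsHypothesis.Theorems.TailFlip.Negative.TailFlipKillTransfer

/-!
# Strategist sketch, route re-audit `r1` — BC2-redirect audit of `ValuativeGCT.TailFlip` (stmt-15687)

Companion of `Cruxes/TailFlip/STRATEGY-CENSUS.md`, Part R1 (this seat,
planner-cstrat-stmt-ValiantsHypothesis-15687-r1-0, 2026-08-17).  The re-audit bins the crux RESTATED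
(at least the summit); an honest reduction would need a typed decomposition `X₁ ∧ … ∧ X_k → TailFlip`
with (a) every piece load-bearing, (b) a proved NON-TRIVIAL assembly, (c) no piece equivalent to
`TailFlip` or to the Statement.  This file records, sorry-free, the Lean facts the census uses to
reject each decomposition CLASS:

* §0 the position of the crux: `TailFlip → ValiantsHypothesis` is a two-step composition of landed
  theorems (`tailFlip_implies_statement`), `TailFlip ↔ ValuativeFlip`.
* §1 REGIONAL seams (by position / slope / exponent / parity / inner subsequence): the killer lemma
  `statement_of_flipsAboveTops` — any piece that, for every `c` and all large `n`, yields ONE flip at or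
  above the window top `W_c(n)` already proves the Statement (border membership is monotone in `m`,
  `not_hasBorderDetRepr_of_flipBody_of_le` + `valiantsHypothesis_of_top_not_hasBorderDetRepr`); and the
  complementary pieces are the crux again by the exponent shift (`highTail_iff_tailFlip`,
  `bigExponents_iff_tailFlip`, `smallSlopes_iff_tailFlip`, `dyadicInner_iff_tailFlip`, `belowHalfTop_iff_tailFlip`).
  Instances: parity pieces (`statement_of_evenTail`, `statement_of_oddTail`), slope-2 piece
  (`statement_of_slopeTwoTail`).
* §2 FUNCTIONAL seams (`dim T_U < F` ∧ `F ≤ mult_pp`): the generic split `PerFloor F ∧ DetCeiling F →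
  TailFlip` is typed and its whole assembly is the 9-line `tailFlip_of_perFloor_detCeiling`
  (`lt_of_lt_of_le` after quantifier bookkeeping) — criterion (b).
* §3 PROPAGATION seams: `DoublingProp` (a flip at `m` propagates to `[m, 2m]` inside the window) is
  EQUIVALENT to the crux over the tree (`doublingProp_iff_tailFlip`, using the landed `HeadFlip_proof`
  only at the bottom `m = n`) — criterion (c).

Nothing here is registered as a line or an item.
-/

set_option linter.dupNamespace false
set_option linter.unusedVariables false

namespace Summit.ValiantsHypothesis.ValiantsHypothesis.Cruxes.TailFlip.StrategistR1

open Literature.NumberTheory.DiophantineGeometry Literature.Computability.AlgebraicComplexity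
open Summit.ValiantsHypothesis.ValiantsHypothesis.Theses.ValuativeGCT
open Summit.ValiantsHypothesis.ValiantsHypothesis.Theorems.ValuativeFlip
open Summit.ValiantsHypothesis.ValiantsHypothesis.Theorems.TailFlip.Negative
open Summit.ValiantsHypothesis.ValiantsHypothesis.Theorems.HeadFlip (HeadFlip_proof)

/-! ## §0 Position of the crux -/

/-- The window top `W_c(n) = 2^((log₂ n + c)^c)`. -/
abbrev W (n c : ℕ) : ℕ := 2 ^ ((Nat.log 2 n + c) ^ c)

example (n c : ℕ) : NeZero (W n c) := inferInstance

/-- **The crux proves the Statement** — two landed steps: the crux puts `W_c(n) < dc̲(per_n)` eventually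
(`window_lt_borderDetComplexityPer_of_tailFlip`) and that is Valiant's hypothesis
(`valiantsHypothesis_of_window_lt_borderDetComplexityPer`).  This is the formal content of the
re-audit's "at least the summit". -/
theorem tailFlip_implies_statement (h : TailFlip) : _root_.ValiantsHypothesis :=
  valiantsHypothesis_of_window_lt_borderDetComplexityPer (window_lt_borderDetComplexityPer_of_tailFlip h)

/-- The crux is its own parent (landed, p117805). -/
example : TailFlip ↔ ValuativeFlip := tailFlip_iff_valuativeFlip

/-- The window top is monotone in the exponent. -/
theorem W_mono_exp {c c' : ℕ} (h : c ≤ c') (n : ℕ) : W n c ≤ W n c' := by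
  apply Nat.pow_le_pow_right (by norm_num)
  rcases Nat.eq_zero_or_pos (Nat.log 2 n + c') with h0 | hpos
  · have hc : c = 0 := by omega
    have hc' : c' = 0 := by omega
    subst hc hc'
    exact le_rfl
  · calc (Nat.log 2 n + c) ^ c ≤ (Nat.log 2 n + c') ^ c := Nat.pow_le_pow_left (by omega) _
      _ ≤ (Nat.log 2 n + c') ^ c' := Nat.pow_le_pow_right hpos h

/-- `W_c(n) ≤ W_{c+1}(n)` and indeed `2 · W_c(n) ≤ W_{c+1}(n)` once `log₂ n + c ≥ 1`: the windows are
nested with room to spare (used for the exponent-shift arguments). -/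
theorem two_mul_W_le_W_succ (n c : ℕ) (h : 1 ≤ Nat.log 2 n + c) : 2 * W n c ≤ W n (c + 1) := by
  have key : (Nat.log 2 n + c) ^ c + 1 ≤ (Nat.log 2 n + (c + 1)) ^ (c + 1) := by
    have h1 : (Nat.log 2 n + c) ^ c ≤ (Nat.log 2 n + (c + 1)) ^ c :=
      Nat.pow_le_pow_left (by omega) _
    have h2 : (Nat.log 2 n + (c + 1)) ^ (c + 1) = (Nat.log 2 n + (c + 1)) ^ c * (Nat.log 2 n + (c + 1)) :=
      pow_succ _ _
    have h3 : 1 ≤ (Nat.log 2 n + (c + 1)) ^ c := Nat.one_le_pow _ _ (by omega)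
    rw [h2]
    calc (Nat.log 2 n + c) ^ c + 1 ≤ (Nat.log 2 n + (c + 1)) ^ c + (Nat.log 2 n + (c + 1)) ^ c := by omega
      _ = (Nat.log 2 n + (c + 1)) ^ c * 2 := by ring
      _ ≤ (Nat.log 2 n + (c + 1)) ^ c * (Nat.log 2 n + (c + 1)) := Nat.mul_le_mul_left _ (by omega)
  calc 2 * W n c = 2 ^ ((Nat.log 2 n + c) ^ c + 1) := by rw [pow_succ]; unfold W; ring
    _ ≤ 2 ^ ((Nat.log 2 n + (c + 1)) ^ (c + 1)) := Nat.pow_le_pow_right (by norm_num) key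

/-! ## §1 Regional seams: one flip above each top is already the Statement -/

/-- **Regional-seam killer.**  A statement that yields, for every exponent `c` and all large `n` (with
`n ≤ W_c(n)`), ONE valuative flip at some level `m ≥ W_c(n)` proves Valiant's hypothesis: the flip
forbids a border determinantal expression at level `m` (`ValuativeBound` + multiplicity-obstruction
principle), non-membership descends to the top `W_c(n)` (`not_hasBorderDetRepr_of_flipBody_of_le`,
Mulmuley–Sohoni padding monotonicity), and non-membership at every top is the route's bridge
(`valiantsHypothesis_of_top_not_hasBorderDetRepr`).  Consequence for decompositions of `TailFlip` by
REGION (position, slope, exponent, parity, subsequence of levels): every piece whose region meets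
`[W_c(n), ∞)` for all `c` and cofinally many… indeed all large `n` is summit-hard (criterion (c)). -/
theorem statement_of_flipsAboveTops
    (H : ∀ c : ℕ, ∃ n₀ : ℕ, ∀ n ≥ n₀, n ≤ W n c → ∃ (m : ℕ) (_ : NeZero m), W n c ≤ m ∧ FlipAt n m) :
    _root_.ValiantsHypothesis := by
  refine valiantsHypothesis_of_top_not_hasBorderDetRepr fun c => ?_
  obtain ⟨n₀, hn₀⟩ := H c
  refine ⟨n₀, fun n hn hnW => ?_⟩
  obtain ⟨m, _, hWm, hflip⟩ := hn₀ n hn hnW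
  exact not_hasBorderDetRepr_of_flipBody_of_le hnW hWm hflip

/-- **Instance: the slope-2 piece alone is summit-hard.**  `TailFlip` restricted to the single slope
`2/1` (flips at `2n < m ≤ W_c(n)`) already proves the Statement: the top `W_{c+2}(n) ≥ 2n + 2` is a
slope-2 tail position (`two_mul_add_two_le_window`). -/
def SlopeTwoTail : Prop :=
  ∀ c : ℕ, ∃ n₀ : ℕ, ∀ n ≥ n₀, ∀ (m : ℕ) [NeZero m], 2 * n < m → m ≤ W n c → FlipAt n m

theorem statement_of_slopeTwoTail (h : SlopeTwoTail) : _root_.ValiantsHypothesis := by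
  refine statement_of_flipsAboveTops fun c => ?_
  obtain ⟨n₀, hn₀⟩ := h (c + 2)
  refine ⟨n₀, fun n hn hnW => ⟨W n (c + 2), inferInstance, W_mono_exp (by omega) n, ?_⟩⟩
  have htop : 2 * n + 2 ≤ W n (c + 2) := two_mul_add_two_le_window c n
  exact hn₀ n hn (W n (c + 2)) (by omega) le_rfl

/-- **Instance: parity pieces are summit-hard.**  "Flips at the EVEN levels of the tail" (and likewise
odd) proves the Statement: window `c + 2` contains an even level `≥ W_c(n)` in its slope-2 tail. -/
def EvenTail : Prop :=
  ∀ a b : ℕ, b < a → ∀ c : ℕ, ∃ n₀ : ℕ, ∀ n ≥ n₀, ∀ (m : ℕ) [NeZero m],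
    a * n < b * m → m ≤ W n c → Even m → FlipAt n m

theorem statement_of_evenTail (h : EvenTail) : _root_.ValiantsHypothesis := by
  refine statement_of_flipsAboveTops fun c => ?_
  obtain ⟨n₀, hn₀⟩ := h 2 1 one_lt_two (c + 2)
  refine ⟨n₀, fun n hn hnW => ⟨W n (c + 2), inferInstance, W_mono_exp (by omega) n, ?_⟩⟩
  have htop : 2 * n + 2 ≤ W n (c + 2) := two_mul_add_two_le_window c n
  have heven : Even (W n (c + 2)) := by
    have hpos : (Nat.log 2 n + (c + 2)) ^ (c + 2) ≠ 0 := by positivity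
    exact (Nat.even_pow' hpos).mpr even_two
  exact hn₀ n hn (W n (c + 2)) (by omega) le_rfl heven

def OddTail : Prop :=
  ∀ a b : ℕ, b < a → ∀ c : ℕ, ∃ n₀ : ℕ, ∀ n ≥ n₀, ∀ (m : ℕ) [NeZero m],
    a * n < b * m → m ≤ W n c → Odd m → FlipAt n m

theorem statement_of_oddTail (h : OddTail) : _root_.ValiantsHypothesis := by
  refine statement_of_flipsAboveTops fun c => ?_
  obtain ⟨n₀, hn₀⟩ := h 2 1 one_lt_two (c + 3)
  refine ⟨n₀, fun n hn hnW => ⟨W n (c + 2) + 1, inferInstance,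
    (W_mono_exp (show c ≤ c + 2 by omega) n).trans (Nat.le_succ _), ?_⟩⟩
  have htop : 2 * n + 2 ≤ W n (c + 2) := two_mul_add_two_le_window c n
  have hodd : Odd (W n (c + 2) + 1) := by
    have hpos : (Nat.log 2 n + (c + 2)) ^ (c + 2) ≠ 0 := by positivity
    exact ((Nat.even_pow' hpos).mpr even_two).add_one
  have hwin : W n (c + 2) + 1 ≤ W n (c + 3) := by
    have hroom : 2 * W n (c + 2) ≤ W n (c + 3) := two_mul_W_le_W_succ n (c + 2) (by omega)
    have h1 : 1 ≤ W n (c + 2) := Nat.one_le_two_pow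
    omega
  exact hn₀ n hn (W n (c + 2) + 1) (by omega) hwin hodd

/-- Layer seam: the piece "flips only BELOW the half-top, `2m ≤ W_c(n)`" is EQUIVALENT to the crux — window `c + 1`
below its half-top already contains the whole of window `c` (`two_mul_W_le_W_succ`); the complementary top layer
`(W_c/2, W_c]` meets every top and is summit-hard by `statement_of_flipsAboveTops`. -/
def BelowHalfTop : Prop :=
  ∀ a b : ℕ, b < a → ∀ c : ℕ, ∃ n₀ : ℕ, ∀ n ≥ n₀, ∀ (m : ℕ) [NeZero m],
    a * n < b * m → 2 * m ≤ W n c → FlipAt n m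

theorem belowHalfTop_iff_tailFlip : BelowHalfTop ↔ TailFlip := by
  constructor
  · intro h a b hba c
    obtain ⟨n₀, hn₀⟩ := h a b hba (c + 1)
    refine ⟨max n₀ 2, fun n hn m _ hlt hm => hn₀ n (le_of_max_le_left hn) m hlt ?_⟩
    have hn2 : 2 ≤ n := le_of_max_le_right hn
    have hlog : 1 ≤ Nat.log 2 n + c := by
      have := Nat.log_pos (b := 2) (by norm_num) hn2
      omega
    exact (Nat.mul_le_mul_left 2 hm).trans (two_mul_W_le_W_succ n c hlog)
  · intro h a b hba c
    obtain ⟨n₀, hn₀⟩ := h a b hba c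
    refine ⟨n₀, fun n hn m _ hlt hm => ?_⟩
    have hm' : m ≤ W n c := by omega
    exact hn₀ n hn m hlt hm'

/-- **The complementary pieces are the crux again (exponent shift).**  Position seam: the piece
"flips at `n^k ≤ m ≤ W_c(n)`" is EQUIVALENT to the crux for every `k ≥ 1` — landed as
`valuativeFlip_iff_polyPadded` + `tailFlip_iff_valuativeFlip`. -/
def HighTail (k : ℕ) : Prop :=
  ∀ c : ℕ, ∃ n₀ : ℕ, ∀ n ≥ n₀, ∀ (m : ℕ) [NeZero m], n ^ k ≤ m → m ≤ W n c → FlipAt n m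

theorem highTail_iff_tailFlip {k : ℕ} (hk : 1 ≤ k) : HighTail k ↔ TailFlip := by
  rw [tailFlip_iff_valuativeFlip, valuativeFlip_iff_polyPadded k hk]
  rfl

/-- Exponent seam: the piece "all exponents `c ≥ c₀`" is EQUIVALENT to the crux (the tail of window
`c` lies in the tail of window `c₀ + c`). -/
def BigExponents (c₀ : ℕ) : Prop :=
  ∀ a b : ℕ, b < a → ∀ c : ℕ, c₀ ≤ c → ∃ n₀ : ℕ, ∀ n ≥ n₀, ∀ (m : ℕ) [NeZero m],
    a * n < b * m → m ≤ W n c → FlipAt n m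

theorem bigExponents_iff_tailFlip (c₀ : ℕ) : BigExponents c₀ ↔ TailFlip := by
  constructor
  · intro h a b hba c
    obtain ⟨n₀, hn₀⟩ := h a b hba (c₀ + c) (by omega)
    exact ⟨n₀, fun n hn m _ hlt hm => hn₀ n hn m hlt (hm.trans (W_mono_exp (by omega) n))⟩
  · intro h a b hba c _
    exact h a b hba c

/-- Slope seam: the piece "all slopes `(b+1)/b` with `b ≥ 2`" (i.e. every slope in `(1, 3/2]`) is
EQUIVALENT to the crux — smaller slopes have larger tails (`tailFlip_iff_succSlopes`). -/
def SmallSlopesTail : Prop :=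
  ∀ b : ℕ, 2 ≤ b → ∀ c : ℕ, ∃ n₀ : ℕ, ∀ n ≥ n₀, ∀ (m : ℕ) [NeZero m],
    (b + 1) * n < b * m → m ≤ W n c → FlipAt n m

theorem smallSlopes_iff_tailFlip : SmallSlopesTail ↔ TailFlip := by
  rw [tailFlip_iff_succSlopes]
  constructor
  · intro h b hb c
    rcases Nat.lt_or_ge b 2 with hb2 | hb2
    · -- `b = 1` (slope 2): the slope-3/2 tail contains the slope-2 tail
      obtain ⟨n₀, hn₀⟩ := h 2 le_rfl c
      refine ⟨n₀, fun n hn m _ hlt hm => hn₀ n hn m ?_ hm⟩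
      interval_cases b
      omega
    · exact h b hb2 c
  · intro h b hb c
    exact h b (by omega) c

/-- Inner-subsequence seam: the piece "only dyadic inner sizes `n = 2^j`" is EQUIVALENT to the crux —
`log₂` is constant on `[2^j, 2^(j+1))`, so the window of `n` IS the window of `2^j`, and the flip body
is upward closed in the inner size at a fixed level (`flipBody_mono_inner`). -/
def DyadicInnerTail : Prop :=
  ∀ a b : ℕ, b < a → ∀ c : ℕ, ∃ j₀ : ℕ, ∀ j ≥ j₀, ∀ (m : ℕ) [NeZero m],
    a * 2 ^ j < b * m → m ≤ W (2 ^ j) c → FlipAt (2 ^ j) m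

theorem dyadicInner_iff_tailFlip : DyadicInnerTail ↔ TailFlip := by
  constructor
  · intro h a b hba c
    obtain ⟨j₀, hj₀⟩ := h a b hba c
    refine ⟨2 ^ j₀, fun n hn m _ hlt hm => ?_⟩
    -- `j = log₂ n ≥ j₀`, `2^j ≤ n < 2^(j+1)`, same window
    set j := Nat.log 2 n with hj
    have hnpos : n ≠ 0 := by
      intro h0; subst h0; exact absurd hn (by simp)
    have hjn : 2 ^ j ≤ n := Nat.pow_log_le_self 2 hnpos
    have hj₀j : j₀ ≤ j := Nat.le_log_of_pow_le (by norm_num) hn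
    have hlog : Nat.log 2 (2 ^ j) = j := Nat.log_pow (by norm_num) j
    have hlt' : a * 2 ^ j < b * m := lt_of_le_of_lt (Nat.mul_le_mul_left a hjn) hlt
    have hm' : m ≤ W (2 ^ j) c := by unfold W; rw [hlog]; exact hm
    have hnm : n ≤ m := (lt_of_slope hba hlt).le
    exact flipBody_mono_inner hjn hnm (hj₀ j hj₀j m hlt' hm')
  · intro h a b hba c
    obtain ⟨n₀, hn₀⟩ := h a b hba c
    refine ⟨n₀, fun j hj m _ hlt hm => hn₀ (2 ^ j) ?_ m hlt hm⟩
    exact hj.trans (Nat.lt_two_pow_self).le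


/-! ## §2 Functional seams: `dim T_U < F` ∧ `F ≤ mult_pp` — the glue is `lt_of_lt_of_le` -/

/-- The crux's valuative truncation `T_U(λ)` at level `m` (verbatim the `let T` of the crux body). -/
noncomputable abbrev trunc (m : ℕ) (U : Submodule ℂ (MatIdx m → ℂ)) (r δ : ℕ) (lam : Nat.Partition (m * δ)) :
    Submodule ℂ (MvPolynomial (MatIdx m × MatIdx m) ℂ) :=
  MvPolynomial.homogeneousSubmodule (MatIdx m × MatIdx m) ℂ (m * δ) ⊓
    ((MvPolynomial.vanishingIdeal ℂ
        {p : MatIdx m × MatIdx m → ℂ | ∀ j : MatIdx m, (fun i => p (j, i)) ∈ U}) ^ (δ * (m - r))).restrictScalars ℂ ⊓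
    (⨅ (M : Matrix (MatIdx m) (MatIdx m) ℂ)
      (_ : linSubst (MatIdx m) ℂ M (detFormLex ℂ m) = detFormLex ℂ m),
      LinearMap.ker ((MvPolynomial.aeval (R := ℂ) fun p : MatIdx m × MatIdx m =>
          ∑ l : MatIdx m, M l p.2 • MvPolynomial.X (p.1, l)).toLinearMap -
        LinearMap.id (R := ℂ) (M := MvPolynomial (MatIdx m × MatIdx m) ℂ))) ⊓
    (⨅ (g : Matrix.GeneralLinearGroup (MatIdx m) ℂ) (_ : IsUpperTriangular g),
      LinearMap.ker ((MvPolynomial.aeval (R := ℂ) fun p : MatIdx m × MatIdx m =>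
          ∑ l : MatIdx m, ((g⁻¹ : Matrix.GeneralLinearGroup (MatIdx m) ℂ) :
            Matrix (MatIdx m) (MatIdx m) ℂ) p.1 l • MvPolynomial.X (l, p.2)).toLinearMap -
        weightChar ((Weight.dualOfPartition (m * m) lam).toMatIdx : Weight (MatIdx m)) g •
          LinearMap.id (R := ℂ) (M := MvPolynomial (MatIdx m × MatIdx m) ℂ)))

/-- The padded-permanent multiplicity `P(n, m, λ) = mult_{λ*} ℂ[Δ_m(X₀₀^{m-n} per_n)]`. -/
noncomputable abbrev perMult (n m δ : ℕ) [NeZero m] (lam : Nat.Partition (m * δ)) : ℕ :=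
  orbitMultiplicity ℂ (paddedPerFormLex ℂ n m) m ((Weight.dualOfPartition (m * m) lam).toMatIdx : Weight (MatIdx m))

/-- Sanity: `FlipAt` is `∃ (U, r, δ, λ), rank ∧ parts ∧ dim trunc < perMult` (definitional). -/
theorem flipAt_iff_trunc (n m : ℕ) [NeZero m] :
    FlipAt n m ↔ ∃ (U : Submodule ℂ (MatIdx m → ℂ)) (r δ : ℕ) (lam : Nat.Partition (m * δ)),
      (∀ u ∈ U, (Matrix.of fun a b : Fin m => u (toLex (a, b))).rank ≤ r) ∧ lam.parts.card ≤ m * m ∧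
        Module.finrank ℂ ↥(trunc m U r δ lam) < perMult n m δ lam :=
  Iff.rfl

/-- A functional FLOOR / CEILING: any `ℕ`-valued function of the position and the shape. -/
abbrev Functional : Type := (n m δ : ℕ) → Nat.Partition (m * δ) → ℕ

/-- **Per half** of a functional seam: at every tail position some admissible shape has
padded-permanent multiplicity at least `F`. -/
def PerFloor (F : Functional) : Prop :=
  ∀ a b : ℕ, b < a → ∀ c : ℕ, ∃ n₀ : ℕ, ∀ n ≥ n₀, ∀ (m : ℕ) [NeZero m], a * n < b * m → m ≤ W n c →
    ∃ (δ : ℕ) (lam : Nat.Partition (m * δ)), lam.parts.card ≤ m * m ∧ F n m δ lam ≤ perMult n m δ lam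

/-- **Det half** of a functional seam: at every tail position and EVERY admissible shape some centre's
truncation is strictly below `F` (it cannot know which shape the per half will choose). -/
def DetCeiling (F : Functional) : Prop :=
  ∀ a b : ℕ, b < a → ∀ c : ℕ, ∃ n₀ : ℕ, ∀ n ≥ n₀, ∀ (m : ℕ) [NeZero m], a * n < b * m → m ≤ W n c →
    ∀ (δ : ℕ) (lam : Nat.Partition (m * δ)), lam.parts.card ≤ m * m →
      ∃ (U : Submodule ℂ (MatIdx m → ℂ)) (r : ℕ),
        (∀ u ∈ U, (Matrix.of fun a b : Fin m => u (toLex (a, b))).rank ≤ r) ∧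
          Module.finrank ℂ ↥(trunc m U r δ lam) < F n m δ lam

/-- **The whole assembly of every functional seam** (criterion (b): this IS the proof — quantifier
bookkeeping and one `lt_of_lt_of_le`; the seam cuts the crux's single inequality at an arbitrary
intermediate value `F`). -/
theorem tailFlip_of_perFloor_detCeiling (F : Functional) (hP : PerFloor F) (hD : DetCeiling F) :
    TailFlip := by
  intro a b hba c
  obtain ⟨n₁, h₁⟩ := hP a b hba c
  obtain ⟨n₂, h₂⟩ := hD a b hba c
  refine ⟨max n₁ n₂, fun n hn m _ hlt hm => ?_⟩
  obtain ⟨δ, lam, hcard, hF⟩ := h₁ n (le_of_max_le_left hn) m hlt hm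
  obtain ⟨U, r, hU, hT⟩ := h₂ n (le_of_max_le_right hn) m hlt hm δ lam hcard
  exact ⟨U, r, δ, lam, hU, hcard, lt_of_lt_of_le hT hF⟩

/-! The canonical collapse (prose, census §R1.2): with `F := perMult` itself the per half is trivially
true and the det half is the crux verbatim — an `F` shared existentially between the halves is the crux
reworded, so an honest functional seam must NAME `F`; every named candidate is examined in the census. -/

/-! ## §3 Propagation seams: doubling propagation is the crux over the tree -/

/-- **Doubling propagation**: eventually in `n`, a flip at level `m ≥ n` propagates to every level
`m' ∈ [m, 2m]` inside the window.  (The unwindowed version is FALSE — it would propagate the landed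
head flips beyond Grenet's bound, `not_flipAt_of_two_pow_le`.) -/
def DoublingProp : Prop :=
  ∀ c : ℕ, ∃ n₀ : ℕ, ∀ n ≥ n₀, ∀ (m m' : ℕ) [NeZero m] [NeZero m'],
    n ≤ m → m ≤ m' → m' ≤ 2 * m → m' ≤ W n c → FlipAt n m → FlipAt n m'

/-- The crux gives doubling propagation outright (its conclusion holds unconditionally, through
`TailFlip ↔ ValuativeFlip`). -/
theorem doublingProp_of_tailFlip (h : TailFlip) : DoublingProp := by
  have hv := valuativeFlip_of_tailFlip h
  intro c
  obtain ⟨n₀, hn₀⟩ := hv c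
  exact ⟨n₀, fun n hn m m' _ _ hnm hmm' _ hW _ => hn₀ n hn m' (hnm.trans hmm') hW⟩

/-- **Doubling propagation proves the crux** — seeded only by the landed BOTTOM flip `FlipAt n n`
(`valuativeFlip_cruxBody_bottom`, `n ≥ 3`) and iterated up the dyadic scales (strong induction on the
level).  So `DoublingProp ↔ TailFlip` over the tree: a propagation piece is the crux, not a part of it
(criterion (c)), even though this assembly is a genuine induction (criterion (b) alone would pass). -/
theorem tailFlip_of_doublingProp (h : DoublingProp) : TailFlip := by
  rw [tailFlip_iff_valuativeFlip]
  intro c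
  obtain ⟨n₁, hn₁⟩ := h c
  refine ⟨max n₁ 3, fun n hn => ?_⟩
  have hn1 : n₁ ≤ n := le_of_max_le_left hn
  have hn3 : 3 ≤ n := le_of_max_le_right hn
  have key : ∀ m : ℕ, ∀ _ : NeZero m, n ≤ m → m ≤ W n c → FlipAt n m := by
    intro m
    induction m using Nat.strong_induction_on with
    | _ m ih =>
      intro _ hnm hmW
      rcases eq_or_lt_of_le hnm with heq | hlt
      · subst heq
        exact valuativeFlip_cruxBody_bottom n hn3
      · haveI : NeZero (max n ((m + 1) / 2)) := ⟨by omega⟩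
        have hlt₁ : max n ((m + 1) / 2) < m := by omega
        have hflip₁ : FlipAt n (max n ((m + 1) / 2)) :=
          ih _ hlt₁ inferInstance (le_max_left _ _) (by omega)
        exact hn₁ n hn1 (max n ((m + 1) / 2)) m (le_max_left _ _) hlt₁.le (by omega) hmW hflip₁
  intro m _ hnm hmW
  exact key m inferInstance hnm hmW

theorem doublingProp_iff_tailFlip : DoublingProp ↔ TailFlip :=
  ⟨tailFlip_of_doublingProp, doublingProp_of_tailFlip⟩

end Summit.ValiantsHypothesis.ValiantsHypothesis.Cruxes.TailFlip.StrategistR1
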